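import Summits.ResolutionOfSingularities.ResolutionOfSingularities.Theorems.PurelyInseparableDim4JointHereditaryNodes
import HarnessLib

/-!
# Purely inseparable four-folds: the NODE STEP for an ABSTRACT MEMBER SYSTEM — survival + host step give the next node
# (brick S3 (c) v4, tranche-independent form of A4; cell `res-dim4-pi`)

[OURS · counted 0] (D-0157 DOOR 2; host item stmt-ResolutionOfSingularities-16155, helper). Nothing here proves resolution of
singularities in dimension ≥ 4 / characteristic `p`. (`res-dim4-typ-3/S3c-V4-ATLAS-MEMBERS-DESIGN.md` §2 A4/A5, made generic so that
every later tranche of the member format — tranche 1 `MemberDataAT`, tranche 2 `MemberDataAD`, … — re-uses ONE node induction.)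

A MEMBER SYSTEM is an abstract member datum `MD M′ c R` (a marked ideal `M′` on a stage `X′`, a closed member `c ⊆ X′`, a finite
«reading set» `R : Finset ρ`) together with a relation `lt` on reading sets, subject to four hypotheses, all of which tranche 1 proved
for `MemberDataAT` (A2 `memberDataAT_survival`, A3 `memberDataAT_host_step`, `coe_member_subset_support_of_atlasZF`,
`acc_readingSet_of_forall_acc`):
* (ADM) a member is an admissible centre: `𝓘(c)` regular, snc with the boundary, `c ⊆ supp M′`;
* (WF) the reading set of a member is `lt`-accessible, `lt` irreflexive;
* (SURV) a member survives the blow-up of a disjoint centre having snc with the boundary (readings unchanged);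
* (HOST) blowing up a member `c` produces finitely many pairwise disjoint CHILDREN over `c`, each a member of the new stage with an
  `lt`-smaller reading set, covering the closed order-`p` points over `c` except finitely many, each of which carries `PointData`.
NODE THEOREM: a node with point members (`PointData`) and pairwise disjoint members of the system covering all closed order-`p` points
has a marked resolution — blow up any member, recurse on `Relation.CutExpand lt` of the multiset of reading sets; with no member left the
point forest (`exists_isMarkedResolution_of_config_local`) finishes.

THIS FILE: `acc_finset_successors_of_forall_acc` (generic form of `acc_readingSet_of_forall_acc`, the (WF) provider),
`pointData_of_not_mem_support` (point members survive disjoint blow-ups), **`member_node_step`** (generic A4). The node theorem itself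
(generic A5) is `…AtlasMemberForest`.

AI-produced formalisation, weaker than expert review. bears_on: LADDER-RESOLUTION:D157-DOOR2 (res-dim4-pi · S3 (c) v4 generic A4).
-/

set_option linter.dupNamespace false -- D-0017: single-problem summit path `Summit.<S>.<S>.…` by design

noncomputable section

open MvPolynomial Finset CategoryTheory AlgebraicGeometry Opposite TopologicalSpace
open AlgebraicGeometry.Scheme.IdealSheafData (ofIdealTop vanishingIdeal)

namespace Summit.ResolutionOfSingularities.ResolutionOfSingularities.Theorems.PIDim4

open Literature.AlgebraicGeometry.Resolution
open Literature.AlgebraicGeometry.Resolution.Hauser2010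
open Literature.AlgebraicGeometry.Resolution.AffinePointBlowup (P A γ coord Wtop ξ)

namespace Equimultiple

section MemberForestStep

variable {K : Type} [Field K] {p : ℕ} [hp : Fact p.Prime] [CharP K p] [DecidableEq K]

omit hp [CharP K p] [DecidableEq K] in
/-- **Finite sets of accessible elements are accessible** for the relation «`R′` non-empty, all its elements `E`-below one element of
`R`, `R′ ≠ R`» (generic form of `acc_readingSet_of_forall_acc`). [folklore] -/
theorem acc_finset_successors_of_forall_acc {ρ : Type} (E : ρ → ρ → Prop) (R : Finset ρ) (h : ∀ r ∈ R, Acc E r) :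
    Acc (fun R' R : Finset ρ => (R'.Nonempty ∧ ∃ r ∈ R, ∀ r' ∈ R', E r' r) ∧ R' ≠ R) R := by
  have key : ∀ r : ρ, Acc E r → ∀ R' : Finset ρ, (∀ r' ∈ R', E r' r) →
      Acc (fun R' R : Finset ρ => (R'.Nonempty ∧ ∃ r ∈ R, ∀ r' ∈ R', E r' r) ∧ R' ≠ R) R' := by
    intro r hr
    induction hr with
    | intro r _ ih =>
      intro R' hR'
      refine Acc.intro R' fun R'' hR'' => ?_
      obtain ⟨⟨-, r₁, hr₁, hall⟩, -⟩ := hR''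
      exact ih r₁ (hR' r₁ hr₁) R'' hall
  refine Acc.intro R fun R' hR' => ?_
  obtain ⟨⟨-, r, hr, hall⟩, -⟩ := hR'
  exact key r (h r hr) R' hall

omit hp [CharP K p] in
/-- **Point members survive the blow-up of a centre missing them**: `PointData` at `π w ∉ V(C)` transports to `w` for the transformed
marked ideal (same state). [cite: StacksProject, Tag 02OS] [cite: BierstoneGrigorievMilmanWlodarczyk2011, Def. 3.1.3] -/
theorem pointData_of_not_mem_support [IsAlgClosed K] {X' W : Scheme.{0}} [IsLocallyNoetherian W] {π : W ⟶ X'}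
    {Ce : X'.IdealSheafData} (hπ : IsBlowup π Ce) (M' : MarkedIdeal X') {w : W} (hw : π w ∉ (Ce.support : Set X'))
    {s : State K} (h : PointData p M' (π w) s) : PointData p (M'.transform π Ce) w s := by
  obtain ⟨hF, hclean, hperm, hacc, hlocfin, Y, φ, ψ, _, _, y, hφ, hψ, hM⟩ := h
  obtain ⟨Y', φ', ψ', _, _, y', hφ', hψ', hMw⟩ :=
    exists_zigzag_comap_controlledTransform_of_not_mem_support hπ hw φ ψ y hφ hψ M'.ideal (hypSheaf p s.F) hM M'.mult
      (w := w) rfl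
  exact ⟨hF, hclean, hperm, hacc, hlocfin, Y', φ', ψ', inferInstance, inferInstance, y', hφ', hψ', hMw⟩

variable [IsAlgClosed K] {ρ : Type}

omit hp [CharP K p] in
/-- **THE NODE STEP OF A MEMBER SYSTEM (generic A4).** Given (SURV) and (HOST) for the member datum `MD` and the relation `lt`: blowing
up one member `c₁` of a pairwise disjoint family with data, the new family (children of `c₁` and preimages of the other members) is
pairwise disjoint with data; the multiset of reading sets loses `Rd c₁` and gains the children's, each `lt`-below `Rd c₁`; members sit
over `c₁` or over an old member; closed order-`p` points over `c₁` are on a new member or carry `PointData`, finitely many off the new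
members; survivors cover. [cite: BierstoneGrigorievMilmanWlodarczyk2011, Def. 3.1.3] [cite: Hauser2010, §§F–G] -/
theorem member_node_step {X' : Scheme.{0}} [IsLocallyNoetherian X']
    (MD : ∀ ⦃X' : Scheme.{0}⦄, MarkedIdeal X' → Closeds X' → Finset ρ → Prop) (lt : Finset ρ → Finset ρ → Prop)
    (hadm : ∀ ⦃X' : Scheme.{0}⦄ [IsLocallyNoetherian X'] (M' : MarkedIdeal X') (c : Closeds X') (R : Finset ρ),
      M'.mult = p → MD M' c R →
      Scheme.IsRegular (vanishingIdeal c).subscheme ∧ HasSNCWith M'.boundary (vanishingIdeal c) ∧ (c : Set X') ⊆ M'.support)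
    (hsurv : ∀ ⦃X' W : Scheme.{0}⦄ [IsLocallyNoetherian X'] [IsLocallyNoetherian W] {π : W ⟶ X'} {Ce : X'.IdealSheafData},
      IsBlowup π Ce → ∀ M' : MarkedIdeal X', M'.mult = p → HasSNCWith M'.boundary Ce →
      ∀ (c : Closeds X') (R : Finset ρ), Disjoint (c : Set X') (Ce.support : Set X') → MD M' c R →
      MD (M'.transform π Ce) (c.preimage π.continuous) R)
    (hhost : ∀ ⦃X' : Scheme.{0}⦄ [IsLocallyNoetherian X'] (M' : MarkedIdeal X'), M'.mult = p →
      ∀ (c : Closeds X') (R : Finset ρ), MD M' c R →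
      ∃ (ι : Type) (I : Finset ι) (kid : ι → Closeds (blowup (vanishingIdeal c))) (Rk : ι → Finset ρ),
        (∀ i ∈ I, MD ((M'.transform (blowup.π (vanishingIdeal c)) (vanishingIdeal c))) (kid i) (Rk i) ∧
          (kid i : Set (blowup (vanishingIdeal c))) ⊆ blowup.π (vanishingIdeal c) ⁻¹' (c : Set X') ∧
          (kid i : Set (blowup (vanishingIdeal c))).Nonempty) ∧
        (∀ i ∈ I, ∀ i' ∈ I, i ≠ i' →
          Disjoint (kid i : Set (blowup (vanishingIdeal c))) (kid i' : Set (blowup (vanishingIdeal c)))) ∧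
        (∀ i ∈ I, lt (Rk i) R) ∧
        (∀ w : blowup (vanishingIdeal c), IsClosed ({w} : Set (blowup (vanishingIdeal c))) →
          blowup.π (vanishingIdeal c) w ∈ (c : Set X') →
          (p : ℕ∞) ≤ idealOrder (M'.transform (blowup.π (vanishingIdeal c)) (vanishingIdeal c)).ideal w →
          (∃ i ∈ I, w ∈ (kid i : Set (blowup (vanishingIdeal c)))) ∨
          ∃ s : State K, PointData p (M'.transform (blowup.π (vanishingIdeal c)) (vanishingIdeal c)) w s) ∧
        {w : blowup (vanishingIdeal c) | IsClosed ({w} : Set (blowup (vanishingIdeal c))) ∧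
          blowup.π (vanishingIdeal c) w ∈ (c : Set X') ∧
          (p : ℕ∞) ≤ idealOrder (M'.transform (blowup.π (vanishingIdeal c)) (vanishingIdeal c)).ideal w ∧
          ∀ i ∈ I, w ∉ (kid i : Set (blowup (vanishingIdeal c)))}.Finite)
    (M' : MarkedIdeal X') (hmult : M'.mult = p) (cms : Finset (Closeds X')) (Rd : Closeds X' → Finset ρ)
    (hcdata : ∀ c ∈ cms, MD M' c (Rd c))
    (hdisj₁ : ∀ c ∈ cms, ∀ c' ∈ cms, c ≠ c' → Disjoint (c : Set X') (c' : Set X')) {c₁ : Closeds X'} (hc₁ : c₁ ∈ cms) :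
    ∃ (cms' : Finset (Closeds (blowup (vanishingIdeal c₁)))) (Rd' : Closeds (blowup (vanishingIdeal c₁)) → Finset ρ),
      (∀ d ∈ cms', MD (M'.transform (blowup.π (vanishingIdeal c₁)) (vanishingIdeal c₁)) d (Rd' d)) ∧
      (∀ d ∈ cms', ∀ d' ∈ cms', d ≠ d' →
        Disjoint (d : Set (blowup (vanishingIdeal c₁))) (d' : Set (blowup (vanishingIdeal c₁)))) ∧
      (∃ KR : Multiset (Finset ρ),
        (∀ R' ∈ KR, lt R' (Rd c₁)) ∧
        (∑ d ∈ cms', ({Rd' d} : Multiset (Finset ρ))) + {Rd c₁} = (∑ c ∈ cms, ({Rd c} : Multiset (Finset ρ))) + KR) ∧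
      (∀ d ∈ cms', ∀ w ∈ (d : Set (blowup (vanishingIdeal c₁))),
        blowup.π (vanishingIdeal c₁) w ∈ (c₁ : Set X') ∨ ∃ c ∈ cms, c ≠ c₁ ∧ blowup.π (vanishingIdeal c₁) w ∈ (c : Set X')) ∧
      (∀ w : blowup (vanishingIdeal c₁), IsClosed ({w} : Set (blowup (vanishingIdeal c₁))) →
        blowup.π (vanishingIdeal c₁) w ∈ (c₁ : Set X') →
        (p : ℕ∞) ≤ idealOrder (M'.transform (blowup.π (vanishingIdeal c₁)) (vanishingIdeal c₁)).ideal w →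
        (∃ d ∈ cms', w ∈ (d : Set (blowup (vanishingIdeal c₁)))) ∨
        ∃ s : State K, PointData p (M'.transform (blowup.π (vanishingIdeal c₁)) (vanishingIdeal c₁)) w s) ∧
      (∀ w : blowup (vanishingIdeal c₁), ∀ c ∈ cms, c ≠ c₁ → blowup.π (vanishingIdeal c₁) w ∈ (c : Set X') →
        ∃ d ∈ cms', w ∈ (d : Set (blowup (vanishingIdeal c₁)))) ∧
      {w : blowup (vanishingIdeal c₁) | IsClosed ({w} : Set (blowup (vanishingIdeal c₁))) ∧
        blowup.π (vanishingIdeal c₁) w ∈ (c₁ : Set X') ∧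
        (p : ℕ∞) ≤ idealOrder (M'.transform (blowup.π (vanishingIdeal c₁)) (vanishingIdeal c₁)).ideal w ∧
        ∀ d ∈ cms', w ∉ (d : Set (blowup (vanishingIdeal c₁)))}.Finite := by
  classical
  obtain ⟨ι, I, kid, Rk, hkid, hkdisj, hklt, hkcover, hkfin⟩ := hhost M' hmult c₁ (Rd c₁) (hcdata c₁ hc₁)
  have hπ : IsBlowup (blowup.π (vanishingIdeal c₁)) (vanishingIdeal c₁) := blowup.isBlowup _
  haveI : IsProper (blowup.π (vanishingIdeal c₁)) := hπ.isProper
  haveI : IsLocallyNoetherian (blowup (vanishingIdeal c₁)) :=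
    LocallyOfFiniteType.isLocallyNoetherian (blowup.π (vanishingIdeal c₁))
  have hCsupp : ((vanishingIdeal c₁).support : Set X') = (c₁ : Set X') := by
    rw [Scheme.IdealSheafData.coe_support_vanishingIdeal]
  have hsncC : HasSNCWith M'.boundary (vanishingIdeal c₁) := (hadm M' c₁ (Rd c₁) hmult (hcdata c₁ hc₁)).2.1
  -- positions and injectivity of the children
  have hkid_over : ∀ i ∈ I, ∀ w ∈ (kid i : Set (blowup (vanishingIdeal c₁))),
      blowup.π (vanishingIdeal c₁) w ∈ (c₁ : Set X') := fun i hi w hw => (hkid i hi).2.1 hw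
  have hkid_inj : ∀ i ∈ I, ∀ i' ∈ I, kid i = kid i' → i = i' := by
    intro i hi i' hi' hee
    by_contra hne
    obtain ⟨w, hw⟩ := (hkid i hi).2.2
    exact Set.disjoint_left.mp (hkdisj i hi i' hi' hne) hw (by rw [← hee]; exact hw)
  -- survivors
  set prei : Closeds X' → Closeds (blowup (vanishingIdeal c₁)) := fun c => c.preimage (blowup.π (vanishingIdeal c₁)).continuous
    with hprei
  have hne₁ : ∀ c ∈ cms.erase c₁, c ≠ c₁ := fun c hc => Finset.ne_of_mem_erase hc
  have hmem₁ : ∀ c ∈ cms.erase c₁, c ∈ cms := fun c hc => Finset.mem_of_mem_erase hc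
  have hdisjC : ∀ c ∈ cms.erase c₁, Disjoint (c : Set X') ((vanishingIdeal c₁).support : Set X') := fun c hc => by
    rw [hCsupp]; exact hdisj₁ c (hmem₁ c hc) c₁ hc₁ (hne₁ c hc)
  have hprei_inj : Set.InjOn prei ↑(cms.erase c₁) := fun c hc c' hc' hcc => by
    have key : ∀ {d d' : Closeds X'}, d ∈ cms.erase c₁ → prei d = prei d' → (d : Set X') ⊆ (d' : Set X') := by
      intro d d' hd hdd x hx
      obtain ⟨w, hw⟩ := exists_eq_of_not_mem_support hπ (Set.disjoint_left.mp (hdisjC d hd) hx)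
      have hw' : w ∈ (prei d : Set (blowup (vanishingIdeal c₁))) := by
        change blowup.π (vanishingIdeal c₁) w ∈ (d : Set X'); rw [hw]; exact hx
      rw [hdd] at hw'
      change blowup.π (vanishingIdeal c₁) w ∈ (d' : Set X') at hw'
      rwa [hw] at hw'
    exact Closeds.ext (Set.Subset.antisymm (key hc hcc) (key hc' hcc.symm))
  have hkid_ne_prei : ∀ i ∈ I, ∀ c ∈ cms.erase c₁, kid i ≠ prei c := fun i hi c hc hec => by
    obtain ⟨w, hw⟩ := (hkid i hi).2.2
    have h1 := hkid_over i hi w hw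
    rw [hec] at hw
    exact Set.disjoint_left.mp (hdisj₁ c (hmem₁ c hc) c₁ hc₁ (hne₁ c hc)) hw h1
  -- the new members
  set kidsF : Finset (Closeds (blowup (vanishingIdeal c₁))) := I.image kid with hkidsF
  set survF : Finset (Closeds (blowup (vanishingIdeal c₁))) := (cms.erase c₁).image prei with hsurvF
  have hmem_kidsF : ∀ d, d ∈ kidsF ↔ ∃ i ∈ I, kid i = d := fun d => by
    simp only [hkidsF, Finset.mem_image]
  have hdisj_ks : Disjoint kidsF survF := Finset.disjoint_left.mpr fun ⦃d⦄ hd hd' => by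
    obtain ⟨i, hi, rfl⟩ := (hmem_kidsF d).mp hd
    obtain ⟨c, hc, hce⟩ := Finset.mem_image.mp hd'
    exact hkid_ne_prei i hi c hc hce.symm
  set cms' : Finset (Closeds (blowup (vanishingIdeal c₁))) := kidsF.disjUnion survF hdisj_ks with hcms'
  have hmem_cms' : ∀ d, d ∈ cms' ↔ (∃ i ∈ I, kid i = d) ∨ ∃ c ∈ cms.erase c₁, prei c = d := fun d => by
    rw [hcms', Finset.mem_disjUnion, hmem_kidsF, hsurvF, Finset.mem_image]
  -- the new reading sets
  set Rd' : Closeds (blowup (vanishingIdeal c₁)) → Finset ρ := fun d =>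
    if h : ∃ i ∈ I, kid i = d then Rk h.choose
    else if h' : ∃ c ∈ cms.erase c₁, prei c = d then Rd h'.choose else ∅ with hRd'
  have hkid_rep : ∀ i ∈ I, Rd' (kid i) = Rk i := by
    intro i hi
    have h : ∃ i' ∈ I, kid i' = kid i := ⟨i, hi, rfl⟩
    have hch : h.choose = i := hkid_inj _ h.choose_spec.1 i hi h.choose_spec.2
    simp only [hRd', dif_pos h]
    rw [hch]
  have hsurv_rep : ∀ c ∈ cms.erase c₁, Rd' (prei c) = Rd c := by
    intro c hc
    have hn₀ : ¬ ∃ i ∈ I, kid i = prei c := fun ⟨i, hi, hec⟩ => hkid_ne_prei i hi c hc hec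
    have h' : ∃ c' ∈ cms.erase c₁, prei c' = prei c := ⟨c, hc, rfl⟩
    have hch : h'.choose = c := hprei_inj h'.choose_spec.1 hc h'.choose_spec.2
    simp only [hRd', dif_neg hn₀, dif_pos h']
    rw [hch]
  -- a singleton sum is a map
  have hsum : ∀ {κ : Type} [DecidableEq κ] (A : Finset κ) (f : κ → Finset ρ),
      ∑ a ∈ A, ({f a} : Multiset (Finset ρ)) = A.val.map f := by
    intro κ _ A f
    induction A using Finset.induction_on with
    | empty => rfl
    | insert a A ha ih => rw [Finset.sum_insert ha, ih, Finset.insert_val_of_notMem ha, Multiset.map_cons, Multiset.singleton_add]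
  have hkidsF_inj : Set.InjOn kid ↑I := fun i hi i' hi' h => hkid_inj i hi i' hi' h
  refine ⟨cms', Rd', fun d hd => ?_, fun d hd d' hd' hdd => ?_, ⟨∑ d ∈ kidsF, ({Rd' d} : Multiset (Finset ρ)), ?_, ?_⟩,
    fun d hd w hw => ?_, fun w hw hwx hord => ?_, fun w c hc hcc hw => ?_, ?_⟩
  · -- member data: children and survivors
    rcases (hmem_cms' d).mp hd with ⟨i, hi, rfl⟩ | ⟨c, hc, rfl⟩
    · rw [hkid_rep i hi]; exact (hkid i hi).1
    · rw [hsurv_rep c hc]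
      exact hsurv hπ M' hmult hsncC c (Rd c) (hdisjC c hc) (hcdata c (hmem₁ c hc))
  · -- pairwise disjoint
    rcases (hmem_cms' d).mp hd with ⟨i, hi, rfl⟩ | ⟨c, hc, rfl⟩
    · rcases (hmem_cms' d').mp hd' with ⟨i', hi', rfl⟩ | ⟨c', hc', rfl⟩
      · exact hkdisj i hi i' hi' fun h => hdd (by rw [h])
      · exact Set.disjoint_left.mpr fun w hw hw' =>
          Set.disjoint_left.mp (hdisj₁ c' (hmem₁ c' hc') c₁ hc₁ (hne₁ c' hc')) hw' (hkid_over i hi w hw)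
    · rcases (hmem_cms' d').mp hd' with ⟨i', hi', rfl⟩ | ⟨c', hc', rfl⟩
      · exact Set.disjoint_left.mpr fun w hw hw' =>
          Set.disjoint_left.mp (hdisj₁ c (hmem₁ c hc) c₁ hc₁ (hne₁ c hc)) hw (hkid_over i' hi' w hw')
      · exact (hdisj₁ c (hmem₁ c hc) c' (hmem₁ c' hc') fun h => hdd (by rw [h])).preimage _
  · -- the children's reading sets are `lt`-below `Rd c₁`
    intro R' hR'
    rw [hsum] at hR'
    obtain ⟨d, hd, rfl⟩ := Multiset.mem_map.mp hR'
    obtain ⟨i, hi, rfl⟩ := (hmem_kidsF d).mp (Finset.mem_val.mp hd)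
    rw [hkid_rep i hi]
    exact hklt i hi
  · -- the multiset identity
    have hs : ∑ d ∈ survF, ({Rd' d} : Multiset (Finset ρ)) = ∑ c ∈ cms.erase c₁, ({Rd c} : Multiset (Finset ρ)) := by
      rw [hsurvF, Finset.sum_image hprei_inj]
      exact Finset.sum_congr rfl fun c hc => by rw [hsurv_rep c hc]
    rw [hcms', Finset.sum_disjUnion, hs, ← Finset.add_sum_erase cms _ hc₁]
    abel
  · -- where members sit
    rcases (hmem_cms' d).mp hd with ⟨i, hi, rfl⟩ | ⟨c, hc, rfl⟩
    · exact Or.inl (hkid_over i hi w hw)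
    · exact Or.inr ⟨c, hmem₁ c hc, hne₁ c hc, hw⟩
  · -- cover over the host, modulo point data
    rcases hkcover w hw hwx hord with ⟨i, hi, hwe⟩ | h
    · exact Or.inl ⟨kid i, (hmem_cms' _).mpr (Or.inl ⟨i, hi, rfl⟩), hwe⟩
    · exact Or.inr h
  · -- survivors cover
    exact ⟨prei c, (hmem_cms' _).mpr (Or.inr ⟨c, Finset.mem_erase.mpr ⟨hcc, hc⟩, rfl⟩), hw⟩
  · -- finiteness of the leftover points
    exact hkfin.subset fun w ⟨hw, hwx, hord, hout⟩ =>
      ⟨hw, hwx, hord, fun i hi => hout _ ((hmem_cms' _).mpr (Or.inl ⟨i, hi, rfl⟩))⟩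

end MemberForestStep

end Equimultiple

end Summit.ResolutionOfSingularities.ResolutionOfSingularities.Theorems.PIDim4

end
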